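import Mathlib.FieldTheory.AbsoluteGaloisGroup
import Mathlib.FieldTheory.Galois.Profinite
import Mathlib.FieldTheory.IsAlgClosed.Basic
import Mathlib.NumberTheory.NumberField.InfinitePlace.Basic
import Mathlib.Analysis.Complex.Basic
import HarnessLib

-- provenance: harness21/H21/H21/Prelude/GalRep/AbsGaloisGroup.lean @ 6de89a0 (interim HEAD d8f2665); M5 mechanical rewrite
/-!
# Absolute Galois groups: glue on top of Mathlib (trunk GalRep, item C2)

Mathlib defines `Field.absoluteGaloisGroup K := AlgebraicClosure K ≃ₐ[K] AlgebraicClosure K`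
(`Mathlib/FieldTheory/AbsoluteGaloisGroup.lean`) as a *non-reducible* `def`, deriving only
`Group`, `TopologicalSpace` (Krull topology) and `IsTopologicalGroup`.  Consequently the natural
action instances of `AlgEquiv` on `AlgebraicClosure K` do **not** synthesise for
`absoluteGaloisGroup K` (verified).  This file transports them with `inferInstanceAs`, and adds:

* `Field.absoluteGaloisGroup.instMulSemiringActionAlgebraicClosure`,
  `Field.absoluteGaloisGroup.instSMulCommClass`, `instSMulCommClass'`, `instFaithfulSMul`,
  `instT2Space`, `instTotallySeparatedSpace`, `instCompactSpace` (char. 0): transported Mathlib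
  instances (`AlgEquiv.applyMulSemiringAction`, `AlgEquiv.apply_smulCommClass'`,
  `AlgEquiv.apply_faithfulSMul`, `krullTopology_t2`, the `TotallySeparatedSpace` instance of
  `Mathlib/FieldTheory/KrullTopology.lean`, the `CompactSpace` instance of
  `Mathlib/FieldTheory/Galois/Profinite.lean` via `IsAlgClosure.isGalois`).  With the
  `SMulCommClass` instance Mathlib's `MulSemiringAction G (integralClosure R _)`
  (`Mathlib/RingTheory/IntegralClosure/Algebra/Basic.lean`) fires downstream, so no further action
  instance is declared anywhere in the trunk.  `Field.absoluteGaloisGroup.toAlgEquiv` (the identity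
  `MulEquiv` to `K̄ ≃ₐ[K] K̄`) and `smul_def` bridge to the `AlgEquiv` API.
* `Literature.absClosureEmbedding K L : AlgebraicClosure K →ₐ[K] AlgebraicClosure L` for an extension
  `L/K` (a fixed choice of `IsAlgClosed.lift`), and the induced continuous restriction
  `Literature.absGaloisRestrict K L : absoluteGaloisGroup L →ₜ* absoluteGaloisGroup K`
  (continuity is proved), with `absGaloisRestrict_apply_smul`, `absGaloisRestrict_injective`,
  `absGaloisRestrict_isConj_of_algHom` (independence of the choice up to conjugacy).
* Complex conjugations: `Literature.IsComplexConjugation φ c` for a real embedding `φ : K →+* ℝ` and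
  `c : absoluteGaloisGroup K`, phrased with Mathlib's `NumberField.ComplexEmbedding.LiesOver` and
  `NumberField.ComplexEmbedding.IsConj` (`∃ ι : K̄ →+* ℂ` over `φ` with `IsConj ι c`); its
  specialisation `Literature.NumberTheory.GaloisRepresentations.IsComplexConjugationAt` to a real infinite place of a number field
  (`NumberField.InfinitePlace.embedding_of_isReal`), and the standard facts
  `exists_isComplexConjugation`, `IsComplexConjugation.sq_eq_one`, `.ne_one`, `.orderOf_eq_two`,
  `.isConj` (all proved from the Mathlib `ComplexEmbedding` API).

Sources: J.-P. Serre, *Abelian ℓ-adic representations and elliptic curves* (1968), Ch. I §2;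
J. Neukirch, *Algebraic Number Theory* (1999), Ch. IV §1 (infinite Galois theory, Krull
topology); J. S. Milne, *Fields and Galois Theory*, §7 (restriction maps between absolute Galois
groups, complex conjugation as an element of `Gal(ℚ̄/ℚ)` well defined up to conjugacy).

Design choices.
* Instances on `Field.absoluteGaloisGroup K` are placed in the Mathlib namespace
  `Field.absoluteGaloisGroup` (deliberate: they are pure transports through the non-reducible
  `def`; no Mathlib instance exists, so nothing is overridden or duplicated).
* The algebra structure `Algebra (AlgebraicClosure K) (AlgebraicClosure L)` coming from the chosen
  embedding is only a *local* instance (`absClosureAlgebra`), together with its scalar tower over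
  `K`; Mathlib already supplies `Algebra K (AlgebraicClosure L)` and
  `IsScalarTower K L (AlgebraicClosure L)`.
-/

noncomputable section

open scoped Topology

namespace Field.absoluteGaloisGroup

variable (K : Type*) [Field K]

/-- The tautological action of the absolute Galois group `Gal(K̄/K)` on `K̄ = AlgebraicClosure K`
by `K`-algebra automorphisms, transported from `AlgEquiv.applyMulSemiringAction` through the
non-reducible definition `Field.absoluteGaloisGroup` (no such Mathlib instance exists).
Ref: Neukirch, *Algebraic Number Theory*, Ch. IV §1. [folklore] -/
instance instMulSemiringActionAlgebraicClosure :
    MulSemiringAction (absoluteGaloisGroup K) (AlgebraicClosure K) :=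
  inferInstanceAs <| MulSemiringAction (AlgebraicClosure K ≃ₐ[K] AlgebraicClosure K) _

/-- The action of `Gal(K̄/K)` on `K̄` commutes with any scalar action factoring through `K`
(e.g. `R = 𝓞 K`, `R = K`, `R = ℤ`); transported from `AlgEquiv.apply_smulCommClass'`.  This is
the instance that makes Mathlib's `MulSemiringAction G (integralClosure R K̄)` available for
`G = absoluteGaloisGroup K`.  Ref: Neukirch, *Algebraic Number Theory*, Ch. I §9. [folklore] -/
instance instSMulCommClass {R : Type*} [SMul R K] [SMul R (AlgebraicClosure K)]
    [IsScalarTower R K (AlgebraicClosure K)] :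
    SMulCommClass (absoluteGaloisGroup K) R (AlgebraicClosure K) :=
  inferInstanceAs <| SMulCommClass (AlgebraicClosure K ≃ₐ[K] AlgebraicClosure K) R _

/-- Symmetric form of `Field.absoluteGaloisGroup.instSMulCommClass`.
Ref: Neukirch, *Algebraic Number Theory*, Ch. I §9. [folklore] -/
instance instSMulCommClass' {R : Type*} [SMul R K] [SMul R (AlgebraicClosure K)]
    [IsScalarTower R K (AlgebraicClosure K)] :
    SMulCommClass R (absoluteGaloisGroup K) (AlgebraicClosure K) :=
  inferInstanceAs <| SMulCommClass R (AlgebraicClosure K ≃ₐ[K] AlgebraicClosure K) _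

/-- The action of `Gal(K̄/K)` on `K̄` is faithful (transport of `AlgEquiv.apply_faithfulSMul`).
Ref: Neukirch, *Algebraic Number Theory*, Ch. IV §1. [folklore] -/
instance instFaithfulSMul : FaithfulSMul (absoluteGaloisGroup K) (AlgebraicClosure K) :=
  inferInstanceAs <| FaithfulSMul (AlgebraicClosure K ≃ₐ[K] AlgebraicClosure K) _

/-- The identification of `Gal(K̄/K) = Field.absoluteGaloisGroup K` with the group of
`K`-algebra automorphisms of `K̄` (the identity, packaged as a `MulEquiv` so that the `AlgEquiv`
API — e.g. `NumberField.ComplexEmbedding.IsConj` — can be used without `show … from`).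
Ref: Neukirch, *Algebraic Number Theory*, Ch. IV §1. [folklore] -/
def toAlgEquiv : absoluteGaloisGroup K ≃* (AlgebraicClosure K ≃ₐ[K] AlgebraicClosure K) :=
  MulEquiv.refl _

variable {K} in
/-- The action of `σ ∈ Gal(K̄/K)` on `K̄` is application of the underlying `K`-algebra
automorphism.  Ref: Neukirch, *Algebraic Number Theory*, Ch. IV §1. [folklore] -/
lemma smul_def (σ : absoluteGaloisGroup K) (x : AlgebraicClosure K) :
    σ • x = toAlgEquiv K σ x := rfl

variable {K} in
/-- `toAlgEquiv` is the identity map.  Ref: Neukirch, *Algebraic Number Theory*, Ch. IV §1. [folklore] -/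
@[simp]
lemma toAlgEquiv_symm_apply (σ : AlgebraicClosure K ≃ₐ[K] AlgebraicClosure K)
    (x : AlgebraicClosure K) : (toAlgEquiv K).symm σ • x = σ x := rfl

/-- The Krull topology on `Gal(K̄/K)` is Hausdorff (transport of `krullTopology_t2`).
Ref: Neukirch, *Algebraic Number Theory*, Ch. IV (1.1). [folklore] -/
instance instT2Space : T2Space (absoluteGaloisGroup K) :=
  inferInstanceAs <| T2Space (AlgebraicClosure K ≃ₐ[K] AlgebraicClosure K)

/-- The Krull topology on `Gal(K̄/K)` is totally separated, hence totally disconnected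
(transport of the Mathlib instance in `Mathlib/FieldTheory/KrullTopology.lean`).
Ref: Neukirch, *Algebraic Number Theory*, Ch. IV (1.1). [folklore] -/
instance instTotallySeparatedSpace : TotallySeparatedSpace (absoluteGaloisGroup K) :=
  inferInstanceAs <| TotallySeparatedSpace (AlgebraicClosure K ≃ₐ[K] AlgebraicClosure K)

/-- In characteristic zero `K̄/K` is Galois, so `Gal(K̄/K)` is compact (hence profinite);
transport of the Mathlib instance `CompactSpace Gal(K/k)` for `[IsGalois k K]`
(`Mathlib/FieldTheory/Galois/Profinite.lean`) via `IsAlgClosure.isGalois`.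
Ref: Neukirch, *Algebraic Number Theory*, Ch. IV (1.1). [folklore] -/
instance instCompactSpace [CharZero K] : CompactSpace (absoluteGaloisGroup K) :=
  inferInstanceAs <| CompactSpace (AlgebraicClosure K ≃ₐ[K] AlgebraicClosure K)

end Field.absoluteGaloisGroup

namespace Literature.NumberTheory.GaloisRepresentations

open Field

section Restrict

variable (K L : Type*) [Field K] [Field L] [Algebra K L]

/-- A fixed (noncanonical) `K`-embedding `K̄ →ₐ[K] L̄` of algebraic closures along an extension
`L/K`, chosen by `IsAlgClosed.lift`.  Any two choices differ by an element of `Gal(L̄/K)`.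
Ref: Milne, *Fields and Galois Theory*, §7 (restriction maps between absolute Galois groups). [folklore] -/
def absClosureEmbedding : AlgebraicClosure K →ₐ[K] AlgebraicClosure L :=
  IsAlgClosed.lift

/-- The `K̄`-algebra structure on `L̄` given by the chosen embedding `absClosureEmbedding K L`.
Only a local instance (it depends on a choice).  Ref: Milne, *Fields and Galois Theory*, §7. [folklore] -/
abbrev absClosureAlgebra : Algebra (AlgebraicClosure K) (AlgebraicClosure L) :=
  (absClosureEmbedding K L).toRingHom.toAlgebra

attribute [local instance] absClosureAlgebra

/-- `K → K̄ → L̄` is a scalar tower for the local algebra structure `absClosureAlgebra K L`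
(the chosen embedding is `K`-linear).  Ref: Milne, *Fields and Galois Theory*, §7. [folklore] -/
lemma absClosure_isScalarTower : IsScalarTower K (AlgebraicClosure K) (AlgebraicClosure L) :=
  IsScalarTower.of_algebraMap_eq fun x => ((absClosureEmbedding K L).commutes x).symm

attribute [local instance] absClosure_isScalarTower

/-- Unfolding lemma for the local algebra structure `absClosureAlgebra K L`.
Ref: Milne, *Fields and Galois Theory*, §7. [folklore] -/
@[simp]
lemma algebraMap_absClosure_apply (x : AlgebraicClosure K) :
    algebraMap (AlgebraicClosure K) (AlgebraicClosure L) x = absClosureEmbedding K L x := rfl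

/-- The underlying group homomorphism of `absGaloisRestrict`: restrict scalars from `L` to `K`,
then restrict to the normal subextension `K̄ ⊆ L̄`.  Ref: Milne, *Fields and Galois Theory*, §7. [folklore] -/
def absGaloisRestrictMonoidHom : absoluteGaloisGroup L →* absoluteGaloisGroup K :=
  (AlgEquiv.restrictNormalHom (F := K) (K₁ := AlgebraicClosure L) (AlgebraicClosure K)).comp
    (AlgEquiv.restrictScalarsHom (R := K) (S := L) (A := AlgebraicClosure L))

/-- Compatibility of the restriction hom with the chosen embedding (unbundled version of
`absGaloisRestrict_apply_smul`).  Ref: Milne, *Fields and Galois Theory*, §7. [folklore] -/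
@[simp]
lemma absClosureEmbedding_absGaloisRestrictMonoidHom_smul (σ : absoluteGaloisGroup L)
    (x : AlgebraicClosure K) :
    absClosureEmbedding K L (absGaloisRestrictMonoidHom K L σ • x) =
      σ • absClosureEmbedding K L x :=
  AlgEquiv.restrictNormal_commutes
    (AlgEquiv.restrictScalars K (show AlgebraicClosure L ≃ₐ[L] AlgebraicClosure L from σ))
    (AlgebraicClosure K) x

/-- The restriction `Gal(L̄/L) → Gal(K̄/K)` is continuous for the Krull topologies: the preimage
of `Gal(K̄/E)`, `E/K` finite, contains `Gal(L̄/E')` where `E'` is generated over `L` by the image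
of a `K`-basis of `E`.  Ref: Neukirch, *Algebraic Number Theory*, Ch. IV §1. [folklore] -/
lemma continuous_absGaloisRestrictMonoidHom : Continuous (absGaloisRestrictMonoidHom K L) := by
  apply continuous_of_continuousAt_one _ (continuousAt_def.mpr _)
  intro N hN
  rw [map_one] at hN
  obtain ⟨E, _, hE⟩ := (krullTopology_mem_nhds_one_iff K (AlgebraicClosure K) N).mp hN
  let b := Module.finBasis K E
  let S : Set (AlgebraicClosure L) := Set.range fun i => absClosureEmbedding K L (b i)
  let E' : IntermediateField L (AlgebraicClosure L) := IntermediateField.adjoin L S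
  haveI : FiniteDimensional L E' :=
    IntermediateField.finiteDimensional_adjoin fun x _ => Algebra.IsIntegral.isIntegral x
  refine (krullTopology_mem_nhds_one_iff L (AlgebraicClosure L) _).mpr
    ⟨E', inferInstance, fun σ hσ => hE ?_⟩
  rw [SetLike.mem_coe, IntermediateField.mem_fixingSubgroup_iff] at hσ
  rw [SetLike.mem_coe, IntermediateField.mem_fixingSubgroup_iff]
  -- `res σ` fixes the basis `b` of `E`, hence all of `E`.
  have hb : ∀ i, absGaloisRestrictMonoidHom K L σ • (b i : AlgebraicClosure K) = b i := by
    intro i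
    apply (absClosureEmbedding K L).toRingHom.injective
    exact (absClosureEmbedding_absGaloisRestrictMonoidHom_smul K L σ (b i)).trans
      (hσ _ (IntermediateField.subset_adjoin L S ⟨i, rfl⟩))
  have key : ((show AlgebraicClosure K ≃ₐ[K] AlgebraicClosure K from
      absGaloisRestrictMonoidHom K L σ).toLinearMap ∘ₗ E.val.toLinearMap) =
      E.val.toLinearMap :=
    b.ext fun i => hb i
  intro x hx
  exact congr($key ⟨x, hx⟩)

/-- The restriction map `Gal(L̄/L) → Gal(K̄/K)` attached to an extension `L/K` and the chosen
embedding `absClosureEmbedding K L : K̄ → L̄`, as a continuous group homomorphism.  For `L/K`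
algebraic it is injective (`absGaloisRestrict_injective`); it is well defined up to conjugation
in `Gal(K̄/K)` (`absGaloisRestrict_isConj_of_algHom`).
Ref: Milne, *Fields and Galois Theory*, §7; Serre, *Abelian ℓ-adic representations* (1968),
I §2.1. [folklore] -/
def absGaloisRestrict : absoluteGaloisGroup L →ₜ* absoluteGaloisGroup K where
  toMonoidHom := absGaloisRestrictMonoidHom K L
  continuous_toFun := continuous_absGaloisRestrictMonoidHom K L

/-- Compatibility of `absGaloisRestrict` with the chosen embedding `K̄ → L̄`:
`ι (res σ • x) = σ • ι x`.  Ref: Milne, *Fields and Galois Theory*, §7. [folklore] -/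
@[simp]
lemma absGaloisRestrict_apply_smul (σ : absoluteGaloisGroup L) (x : AlgebraicClosure K) :
    absClosureEmbedding K L (absGaloisRestrict K L σ • x) = σ • absClosureEmbedding K L x :=
  absClosureEmbedding_absGaloisRestrictMonoidHom_smul K L σ x

/-- For an algebraic extension `L/K` the restriction `Gal(L̄/L) → Gal(K̄/K)` is injective
(then `L̄ = K̄`).  Ref: Milne, *Fields and Galois Theory*, §7. [folklore] -/
theorem absGaloisRestrict_injective [Algebra.IsAlgebraic K L] :
    Function.Injective (absGaloisRestrict K L) := by
  intro σ τ h
  haveI : Algebra.IsAlgebraic (AlgebraicClosure K) (AlgebraicClosure L) :=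
    Algebra.IsAlgebraic.tower_top (K := K) (AlgebraicClosure K)
  have hsurj := (IsAlgClosed.algebraMap_bijective_of_isIntegral
    (k := AlgebraicClosure K) (K := AlgebraicClosure L)).2
  refine AlgEquiv.ext (R := L) (A₁ := AlgebraicClosure L) (A₂ := AlgebraicClosure L) fun y => ?_
  obtain ⟨x, rfl⟩ := hsurj y
  change σ • absClosureEmbedding K L x = τ • absClosureEmbedding K L x
  rw [← absGaloisRestrict_apply_smul, ← absGaloisRestrict_apply_smul, h]

/-- In characteristic zero the image of `Gal(L̄/L) → Gal(K̄/K)` is closed (continuous image of a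
compact space in a Hausdorff space).  Ref: Neukirch, *Algebraic Number Theory*, Ch. IV §1. [folklore] -/
theorem isClosed_range_absGaloisRestrict [CharZero L] :
    IsClosed (Set.range (absGaloisRestrict K L)) :=
  (isCompact_range (absGaloisRestrict K L).continuous).isClosed

/-- Independence of the choice of embedding up to conjugacy: if `ι' : K̄ →ₐ[K] L̄` is any other
`K`-embedding and `r' : Gal(L̄/L) → Gal(K̄/K)` is compatible with `ι'`
(`ι' (r' σ • x) = σ • ι' x`), then `r' σ` is conjugate to `absGaloisRestrict K L σ`, by an
element of `Gal(K̄/K)` independent of `σ`.  Ref: Milne, *Fields and Galois Theory*, §7. [cite: MilneFT2022, Ch. 7 (the absolute Galois group: restriction well defined up to conjugacy)] -/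
def absGaloisRestrict_isConj_of_algHom : Prop :=
  ∀ (ι' : AlgebraicClosure K →ₐ[K] AlgebraicClosure L) (r' : absoluteGaloisGroup L → absoluteGaloisGroup K) (hr' : ∀ (σ : absoluteGaloisGroup L) (x : AlgebraicClosure K), ι' (r' σ • x) = σ • ι' x),
    ∃ τ : absoluteGaloisGroup K, ∀ σ : absoluteGaloisGroup L,
      r' σ = τ * absGaloisRestrict K L σ * τ⁻¹

end Restrict

section ComplexConjugation

open NumberField

variable {K : Type*} [Field K]

/-- `c ∈ Gal(K̄/K)` is *a complex conjugation for the real embedding* `φ : K →+* ℝ` if there is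
an embedding `ι : K̄ →+* ℂ` extending `φ` under which `c` acts as complex conjugation:
`ι (c • x) = conj (ι x)`.  Stated with Mathlib's `NumberField.ComplexEmbedding.LiesOver` and
`NumberField.ComplexEmbedding.IsConj`; see `isComplexConjugation_iff` for the unfolded form.
Ref: Serre, *Abelian ℓ-adic representations* (1968), I §2.2;
Milne, *Fields and Galois Theory*, §7. [folklore] -/
def IsComplexConjugation (φ : K →+* ℝ) (c : absoluteGaloisGroup K) : Prop :=
  ∃ ι : AlgebraicClosure K →+* ℂ, ComplexEmbedding.LiesOver ι (Complex.ofRealHom.comp φ) ∧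
    ComplexEmbedding.IsConj ι (absoluteGaloisGroup.toAlgEquiv K c)

/-- Unfolded form of `IsComplexConjugation`: `ι` extends `φ` and `ι (c • x) = conj (ι x)`.
Ref: Serre, *Abelian ℓ-adic representations* (1968), I §2.2. [folklore] -/
theorem isComplexConjugation_iff {φ : K →+* ℝ} {c : absoluteGaloisGroup K} :
    IsComplexConjugation φ c ↔ ∃ ι : AlgebraicClosure K →+* ℂ,
      ι.comp (algebraMap K (AlgebraicClosure K)) = Complex.ofRealHom.comp φ ∧
      ∀ x : AlgebraicClosure K, ι (c • x) = starRingEnd ℂ (ι x) := by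
  refine exists_congr fun ι => and_congr ComplexEmbedding.liesOver_iff ⟨fun h x => ?_, fun h => ?_⟩
  · exact h.eq x
  · exact RingHom.ext fun x => (h x).symm

/-- The nontrivial `K̄`-fact behind `IsComplexConjugation.ne_one`: no embedding `K̄ →+* ℂ` is
real, since `K̄` contains a square root of `-1`.
Ref: Serre, *Abelian ℓ-adic representations* (1968), I §2.2. [folklore] -/
theorem not_isReal_of_algebraicClosure (ι : AlgebraicClosure K →+* ℂ) :
    ¬ ComplexEmbedding.IsReal ι := by
  intro h
  obtain ⟨i, hi⟩ := IsAlgClosed.exists_eq_mul_self (-1 : AlgebraicClosure K)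
  have him : (ι i).im = 0 := Complex.conj_eq_iff_im.mp (RingHom.congr_fun h i)
  have hre := congr(Complex.re $(congr(ι $hi)))
  simp only [map_neg, map_one, map_mul, Complex.neg_re, Complex.one_re, Complex.mul_re, him,
    mul_zero, sub_zero] at hre
  nlinarith [mul_self_nonneg (ι i).re]

/-- `c ∈ Gal(K̄/K)` is a complex conjugation at the real infinite place `w` of `K`
(with respect to the real embedding `NumberField.InfinitePlace.embedding_of_isReal hw`, whose
composition with `ℝ → ℂ` is `w.embedding`, see `isComplexConjugationAt_iff`).
Ref: Serre, *Abelian ℓ-adic representations* (1968), I §2.2. [folklore] -/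
abbrev IsComplexConjugationAt {w : NumberField.InfinitePlace K} (hw : w.IsReal)
    (c : absoluteGaloisGroup K) : Prop :=
  IsComplexConjugation (NumberField.InfinitePlace.embedding_of_isReal hw) c

/-- `IsComplexConjugationAt hw c` in terms of `w.embedding : K →+* ℂ`.
Ref: Serre, *Abelian ℓ-adic representations* (1968), I §2.2. [folklore] -/
theorem isComplexConjugationAt_iff {w : NumberField.InfinitePlace K} (hw : w.IsReal)
    (c : absoluteGaloisGroup K) :
    IsComplexConjugationAt hw c ↔ ∃ ι : AlgebraicClosure K →+* ℂ,
      ComplexEmbedding.LiesOver ι w.embedding ∧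
      ComplexEmbedding.IsConj ι (absoluteGaloisGroup.toAlgEquiv K c) := by
  have : Complex.ofRealHom.comp (NumberField.InfinitePlace.embedding_of_isReal hw) =
      w.embedding :=
    RingHom.ext fun x => NumberField.InfinitePlace.embedding_of_isReal_apply hw x
  simp only [IsComplexConjugationAt, IsComplexConjugation, this]

/-- A real embedding forces characteristic zero.  (Auxiliary.)
Ref: Neukirch, *Algebraic Number Theory*, Ch. I §1. [folklore] -/
theorem charZero_of_realEmbedding (φ : K →+* ℝ) : CharZero K :=
  φ.charZero

/-- Every real embedding `φ : K →+* ℝ` admits a complex conjugation in `Gal(K̄/K)`: embed `K̄`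
into `ℂ` over `φ` by `ι`; then `conj ∘ ι` also lies over `φ`, so (`K̄/K` being Galois in
characteristic zero) `conj ∘ ι = ι ∘ c` for some `c ∈ Gal(K̄/K)`
(`NumberField.ComplexEmbedding.exists_comp_symm_eq_of_comp_eq`).
Ref: Milne, *Fields and Galois Theory*, §7. [folklore] -/
theorem exists_isComplexConjugation (φ : K →+* ℝ) :
    ∃ c : absoluteGaloisGroup K, IsComplexConjugation φ c := by
  haveI : CharZero K := charZero_of_realEmbedding φ
  letI : Algebra K ℂ := (Complex.ofRealHom.comp φ).toAlgebra
  let ι : AlgebraicClosure K →ₐ[K] ℂ := IsAlgClosed.lift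
  have hι : (ι : AlgebraicClosure K →+* ℂ).comp (algebraMap K (AlgebraicClosure K)) =
      Complex.ofRealHom.comp φ := ι.comp_algebraMap
  have hι' : (ComplexEmbedding.conjugate (ι : AlgebraicClosure K →+* ℂ)).comp
      (algebraMap K (AlgebraicClosure K)) = Complex.ofRealHom.comp φ := by
    ext1 x
    have hx := RingHom.congr_fun hι x
    rw [RingHom.comp_apply] at hx
    rw [RingHom.comp_apply, ComplexEmbedding.conjugate_coe_eq, hx, RingHom.comp_apply,
      Complex.ofRealHom_eq_coe, Complex.conj_ofReal]
  obtain ⟨σ, hσ⟩ := ComplexEmbedding.exists_comp_symm_eq_of_comp_eq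
    (k := K) (K := AlgebraicClosure K) _ _ (hι.trans hι'.symm)
  exact ⟨(absoluteGaloisGroup.toAlgEquiv K).symm σ.symm, ι,
    ComplexEmbedding.liesOver_iff.mpr hι, hσ.symm⟩

variable {φ : K →+* ℝ} {c c' : absoluteGaloisGroup K}

/-- A complex conjugation is an involution: `c ^ 2 = 1`
(from `NumberField.ComplexEmbedding.isConj_apply_apply`).
Ref: Serre, *Abelian ℓ-adic representations* (1968), I §2.2. [folklore] -/
theorem IsComplexConjugation.sq_eq_one (hc : IsComplexConjugation φ c) : c ^ 2 = 1 := by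
  obtain ⟨ι, -, hι⟩ := hc
  refine FaithfulSMul.eq_of_smul_eq_smul (α := AlgebraicClosure K) fun x => ?_
  rw [pow_two, mul_smul, one_smul, absoluteGaloisGroup.smul_def, absoluteGaloisGroup.smul_def]
  exact ComplexEmbedding.isConj_apply_apply hι x

/-- A complex conjugation is nontrivial (`K̄` is not formally real: it contains `√-1`);
from `NumberField.ComplexEmbedding.isConj_ne_one_iff` and `not_isReal_of_algebraicClosure`.
Ref: Serre, *Abelian ℓ-adic representations* (1968), I §2.2. [folklore] -/
theorem IsComplexConjugation.ne_one (hc : IsComplexConjugation φ c) : c ≠ 1 := by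
  obtain ⟨ι, -, hι⟩ := hc
  exact (ComplexEmbedding.isConj_ne_one_iff hι).mpr (not_isReal_of_algebraicClosure ι)

/-- A complex conjugation has order `2`
(cf. `NumberField.ComplexEmbedding.orderOf_isConj_two_of_ne_one`).
Ref: Serre, *Abelian ℓ-adic representations* (1968), I §2.2. [folklore] -/
theorem IsComplexConjugation.orderOf_eq_two (hc : IsComplexConjugation φ c) : orderOf c = 2 :=
  orderOf_eq_prime_iff.mpr ⟨hc.sq_eq_one, hc.ne_one⟩

/-- Any two complex conjugations attached to the same real embedding are conjugate in
`Gal(K̄/K)`: the two embeddings `ι, ι'` over `φ` differ by some `ν ∈ Gal(K̄/K)`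
(`NumberField.ComplexEmbedding.exists_comp_symm_eq_of_comp_eq`), and then
`NumberField.ComplexEmbedding.IsConj.comp` / `.ext` give `c' = ν c ν⁻¹`.
Ref: Milne, *Fields and Galois Theory*, §7. [folklore] -/
theorem IsComplexConjugation.isConj (hc : IsComplexConjugation φ c)
    (hc' : IsComplexConjugation φ c') : IsConj c c' := by
  haveI : CharZero K := charZero_of_realEmbedding φ
  obtain ⟨ι, hι, hιc⟩ := hc
  obtain ⟨ι', hι', hιc'⟩ := hc'
  obtain ⟨ν, hν⟩ := ComplexEmbedding.exists_comp_symm_eq_of_comp_eq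
    (k := K) (K := AlgebraicClosure K) ι ι' (hι.over.trans hι'.over.symm)
  have h := hιc.comp ν.symm
  rw [hν] at h
  exact isConj_iff.mpr ⟨(absoluteGaloisGroup.toAlgEquiv K).symm ν.symm⁻¹, h.ext hιc'⟩

end ComplexConjugation

end Literature.NumberTheory.GaloisRepresentations
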